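import Summits.AtomisticToContinuum.HydrodynamicLimit.Theorems.AntiMazurCoboundariesCellForecastPressureDecayEnskogObjects
import Literature.MathematicalPhysics.StatisticalMechanics.HardCoreCanonical
import HarnessLib

/-!
# S2c(B) · tree bounds with two-body weights for the canonical hard-core gas
# (second file of stub `stub_contactStatistics`, crux line `enskog-compensator-martingale`,
# crux `CellForecastPressureDecay`, stmt-AtomisticToContinuum-13915)

Generic bounds for the canonical hard-core gas of independent points
(`Literature/MathematicalPhysics/StatisticalMechanics/HardCoreCanonical`: labels `ι`, one-point law `ν`,
symmetric measurable overlap relation `O` with `ν{y : O z y} ≤ p`, Ursell weights `u_B`, tree numbers `t`),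
complementing the tree bound `lintegral_mul_aU_le` (ONE one-body weight at the root) by the bounds with a
TWO-BODY weight `Φ(x_u, x_v)` that the near-contact pair statistics `ContactStatistics` of the line need
(there the weight is `𝟙[x_u ∈ boundary layer] · |φ(x_u − x_v)|`, and `∫ Φ(z, y) dν(y)` carries the small volume
of the contact shell):

* § 1 `lintegral_mul_mul₂_aU_le` — **two marked points in one block**: for `u ≠ v` in `B`,
  `∫⁻ φ(x_u) Φ(x_u,x_v) |u_B| dℙ ≤ (∫⁻ φ(z) (∫⁻ Φ(z,y) dν(y)) dν(z)) · t(#B) p^{#B−2}` — one step of the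
  rooted recursion at `u` (`abs_uR_le_sum_setPartitions`), independent blocks of `B ∖ u`, the block of `v`
  carrying the weight (tree bound rooted at `v`), every other block one overlap indicator;
  `∑_ρ ∏_Q #Q t(#Q) = t(#B)`.
* § 2 the registered sub-goal `stub_contactStatistics_treeBound` (labels `Fin n`, points in `ℝ³`).
The companion bound with the two marked points in two disjoint blocks is in the tail file of the stub.

References: E. Pulvirenti, D. Tsagkarogiannis, Comm. Math. Phys. 316 (2012) 289–306, §4 (tree-graph bound
on the activities of the canonical polymer representation); S. Friedli, Y. Velenik, *Statistical Mechanics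
of Lattice Systems* (2017), §5.4 (5.13)–(5.15).
-/

noncomputable section

open MeasureTheory ProbabilityTheory Set Filter Finset
open scoped ENNReal BigOperators
open Literature.Analysis.FluidPDE Literature.MathematicalPhysics.KineticTheory
open Literature.MathematicalPhysics.StatisticalMechanics
open Literature.Probability.LatticeModels (setPartitions mem_setPartitions IsSetPartition treeNumber
  sum_setPartitions_prod_card_mul_treeNumber blockOf)

namespace Summit.AtomisticToContinuum.HydrodynamicLimit.Theorems.EnskogCompensator

section Generic

variable {ι : Type*} [Fintype ι] [DecidableEq ι] {X : Type*} [MeasurableSpace X] {O : X → X → Prop}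
variable (ν : Measure X) [IsProbabilityMeasure ν]

/-! ## § 1 Two marked points in one block: the two-weight tree bound -/

omit [Fintype ι] [DecidableEq ι] in
/-- The overlap indicator of a configuration point against a fixed point is jointly measurable. [folklore] -/
theorem measurable_olap_snd_apply (hO : MeasurableSet {p : X × X | O p.1 p.2}) (u' : ι) :
    Measurable fun q : (ι → X) × X => olap O q.2 (q.1 u') := by
  have h1 : (fun q : (ι → X) × X => olap O q.2 (q.1 u')) =
      ({q : (ι → X) × X | O q.2 (q.1 u')}).indicator 1 := by
    funext q; unfold olap; split_ifs with h
    · rw [Set.indicator_of_mem (by exact h)]; rfl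
    · rw [Set.indicator_of_notMem (by exact h)]
  rw [h1]
  exact measurable_one.indicator
    (hO.preimage (measurable_snd.prodMk ((measurable_pi_apply u').comp measurable_fst)))

omit [Fintype ι] in
/-- The block weight `(∑_{u' ∈ Q} 𝟙[O y (x u')]) |u_Q(x)|` of the rooted recursion is jointly measurable
in `(x, y)`. [folklore] -/
theorem measurable_blockWeight (hO : MeasurableSet {p : X × X | O p.1 p.2}) (Q : Finset ι) :
    Measurable fun q : (ι → X) × X =>
      ENNReal.ofReal ((∑ u' ∈ Q, olap O q.2 (q.1 u')) * |uR O q.1 Q|) :=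
  ENNReal.measurable_ofReal.comp ((Finset.measurable_sum _ fun u' _ => measurable_olap_snd_apply hO u').mul
    ((measurable_uR hO Q).comp measurable_fst).abs)

omit [Fintype ι] [MeasurableSpace X] in
/-- The block weight depends only on the coordinates of the block. [folklore] -/
theorem dependsOn_blockWeight (Q : Finset ι) (y : X) :
    DependsOn (fun x : ι → X => ENNReal.ofReal ((∑ u' ∈ Q, olap O y (x u')) * |uR O x Q|)) (Q : Set ι) := by
  intro x x' hxx'
  have h2 : uR O x Q = uR O x' Q := dependsOn_uR Q hxx'
  simp only
  rw [h2, Finset.sum_congr rfl fun u' hu' => by rw [hxx' u' hu']]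

omit [Fintype ι] [MeasurableSpace X] in
/-- Splitting the block weight over the overlapping point. [folklore] -/
theorem blockWeight_eq_sum (Q : Finset ι) (y : X) (x : ι → X) :
    ENNReal.ofReal ((∑ u' ∈ Q, olap O y (x u')) * |uR O x Q|) =
      ∑ u' ∈ Q, ENNReal.ofReal (olap O y (x u')) * aU O x Q := by
  simp only [aU]
  rw [Finset.sum_mul, ENNReal.ofReal_sum_of_nonneg fun u' _ => mul_nonneg (olap_nonneg _ _) (abs_nonneg _)]
  exact Finset.sum_congr rfl fun u' _ => ENNReal.ofReal_mul (olap_nonneg _ _)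

/-- **A plain block**: `∫⁻ (∑_{u' ∈ Q} 𝟙[O y (x u')]) |u_Q| dℙ ≤ #Q · t(#Q) · p^{#Q}` (tree bound rooted at
the point overlapping `y`). [cite: PulvirentiTsagkarogiannis2012, §4] -/
theorem lintegral_blockWeight_le (hO : MeasurableSet {p : X × X | O p.1 p.2})
    (hOs : ∀ a b, O a b → O b a) {p : ℝ} (hp0 : 0 ≤ p)
    (hp : ∀ z, ν {y | O z y} ≤ ENNReal.ofReal p) {Q : Finset ι} (hQne : Q.Nonempty) (y : X) :
    ∫⁻ x, ENNReal.ofReal ((∑ u' ∈ Q, olap O y (x u')) * |uR O x Q|) ∂Measure.pi (fun _ : ι => ν) ≤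
      ENNReal.ofReal ((Q.card : ℝ) * treeNumber Q.card * p ^ Q.card) := by
  simp_rw [blockWeight_eq_sum]
  have hmeas_u' : ∀ u' : ι, Measurable fun x : ι → X => ENNReal.ofReal (olap O y (x u')) := fun u' =>
    ENNReal.measurable_ofReal.comp ((measurable_olap_snd_apply hO u').comp
      (measurable_id.prodMk measurable_const))
  simp_rw [show ∀ x : ι → X, (∑ u' ∈ Q, ENNReal.ofReal (olap O y (x u')) * aU O x Q) =
    ∑ u' ∈ Q, (fun u' x => ENNReal.ofReal (olap O y (x u')) * aU O x Q) u' x from fun x => rfl]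
  rw [lintegral_finsetSum Q (f := fun u' x => ENNReal.ofReal (olap O y (x u')) * aU O x Q)
    (fun u' _ => (hmeas_u' u').mul (measurable_aU hO Q))]
  have hterm : ∀ u' ∈ Q, ∫⁻ x, ENNReal.ofReal (olap O y (x u')) * aU O x Q ∂Measure.pi (fun _ : ι => ν) ≤
      ENNReal.ofReal p * ENNReal.ofReal (treeNumber Q.card * p ^ (Q.card - 1)) := by
    intro u' hu'
    have hφ' : Measurable fun b : X => ENNReal.ofReal (olap O y b) :=
      ENNReal.measurable_ofReal.comp (measurable_olap_right hO y)
    refine (lintegral_mul_aU_le ν hO hOs hp0 hp Q hu' hφ').trans ?_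
    gcongr
    rw [lintegral_ofReal_olap hO ν y]
    exact hp y
  calc ∑ u' ∈ Q, ∫⁻ x, ENNReal.ofReal (olap O y (x u')) * aU O x Q ∂Measure.pi (fun _ : ι => ν)
      ≤ ∑ _u' ∈ Q, ENNReal.ofReal p * ENNReal.ofReal (treeNumber Q.card * p ^ (Q.card - 1)) :=
        Finset.sum_le_sum hterm
    _ = ENNReal.ofReal ((Q.card : ℝ) * treeNumber Q.card * p ^ Q.card) := by
        have hk : Q.card = (Q.card - 1) + 1 := (Nat.succ_pred_eq_of_pos (Finset.card_pos.2 hQne)).symm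
        have hpow : p ^ Q.card = p ^ (Q.card - 1) * p := by
          rw [← pow_succ]; exact congrArg (p ^ ·) hk
        have hreal : (Q.card : ℝ) * (p * (treeNumber Q.card * p ^ (Q.card - 1))) =
            Q.card * treeNumber Q.card * p ^ Q.card := by
          rw [hpow]; ring
        rw [Finset.sum_const, nsmul_eq_mul, ← ENNReal.ofReal_mul hp0,
          ← ENNReal.ofReal_natCast, ← ENNReal.ofReal_mul (Nat.cast_nonneg _), hreal]

/-- **A weighted block**: for `v ∈ Q` and a measurable weight `Ψ ≥ 0`,
`∫⁻ Ψ(x_v) (∑_{u' ∈ Q} 𝟙[O y (x u')]) |u_Q| dℙ ≤ #Q · (∫⁻ Ψ dν) · t(#Q) p^{#Q−1}` (drop the overlap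
indicators, tree bound rooted at `v`). [cite: PulvirentiTsagkarogiannis2012, §4] -/
theorem lintegral_mul_blockWeight_le (hO : MeasurableSet {p : X × X | O p.1 p.2})
    (hOs : ∀ a b, O a b → O b a) {p : ℝ} (hp0 : 0 ≤ p)
    (hp : ∀ z, ν {y | O z y} ≤ ENNReal.ofReal p) {Q : Finset ι} {v : ι} (hv : v ∈ Q) (y : X)
    {Ψ : X → ℝ≥0∞} (hΨ : Measurable Ψ) :
    ∫⁻ x, Ψ (x v) * ENNReal.ofReal ((∑ u' ∈ Q, olap O y (x u')) * |uR O x Q|) ∂Measure.pi (fun _ : ι => ν) ≤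
      ENNReal.ofReal (Q.card : ℝ) * ((∫⁻ b, Ψ b ∂ν) * ENNReal.ofReal (treeNumber Q.card * p ^ (Q.card - 1))) := by
  have hle : ∀ x : ι → X, Ψ (x v) * ENNReal.ofReal ((∑ u' ∈ Q, olap O y (x u')) * |uR O x Q|) ≤
      ∑ _u' ∈ Q, Ψ (x v) * aU O x Q := by
    intro x
    rw [blockWeight_eq_sum, Finset.mul_sum]
    refine Finset.sum_le_sum fun u' _ => ?_
    rw [← mul_assoc]
    refine mul_le_mul' (mul_le_of_le_one_right' ?_) le_rfl
    exact ENNReal.ofReal_le_one.2 (olap_le_one _ _)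
  calc ∫⁻ x, Ψ (x v) * ENNReal.ofReal ((∑ u' ∈ Q, olap O y (x u')) * |uR O x Q|) ∂Measure.pi (fun _ : ι => ν)
      ≤ ∫⁻ x, ∑ _u' ∈ Q, Ψ (x v) * aU O x Q ∂Measure.pi (fun _ : ι => ν) := lintegral_mono hle
    _ = ∑ _u' ∈ Q, ∫⁻ x, Ψ (x v) * aU O x Q ∂Measure.pi (fun _ : ι => ν) :=
        lintegral_finsetSum _ fun u' _ => (hΨ.comp (measurable_pi_apply v)).mul (measurable_aU hO Q)
    _ ≤ ∑ _u' ∈ Q, (∫⁻ b, Ψ b ∂ν) * ENNReal.ofReal (treeNumber Q.card * p ^ (Q.card - 1)) :=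
        Finset.sum_le_sum fun u' _ => lintegral_mul_aU_le ν hO hOs hp0 hp Q hv hΨ
    _ = ENNReal.ofReal (Q.card : ℝ) * ((∫⁻ b, Ψ b ∂ν) * ENNReal.ofReal (treeNumber Q.card * p ^ (Q.card - 1))) := by
        rw [Finset.sum_const, nsmul_eq_mul, ENNReal.ofReal_natCast]

omit [Fintype ι] in
/-- Exponent bookkeeping for the two-weight tree bound: singling out the block `Qv` of a set partition
`ρ` of `B ∖ u`, `#Qv t(#Qv) p^{#Qv−1} ∏_{Q ≠ Qv} #Q t(#Q) p^{#Q} = (∏_Q #Q t(#Q)) p^{#B−2}`. [folklore] -/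
theorem blockProduct_eq {B : Finset ι} {u : ι} (hu : u ∈ B) {ρ : Finset (Finset ι)}
    (hρ : IsSetPartition (B.erase u) ρ) {Qv : Finset ι} (hQv : Qv ∈ ρ) (p : ℝ) :
    (Qv.card : ℝ) * (treeNumber Qv.card * p ^ (Qv.card - 1)) *
        ∏ Q ∈ ρ.erase Qv, ((Q.card : ℝ) * treeNumber Q.card * p ^ Q.card) =
      (∏ Q ∈ ρ, ((Q.card * treeNumber Q.card : ℕ) : ℝ)) * p ^ (B.card - 2) := by
  have hexp : (Qv.card - 1) + ∑ Q ∈ ρ.erase Qv, Q.card = B.card - 2 := by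
    have h1 : ∑ Q ∈ ρ, Q.card = B.card - 1 := by rw [hρ.sum_card, card_erase_of_mem hu]
    have h2 : Qv.card + ∑ Q ∈ ρ.erase Qv, Q.card = ∑ Q ∈ ρ, Q.card := Finset.add_sum_erase ρ _ hQv
    have h3 : 1 ≤ Qv.card := Finset.card_pos.2 (hρ.nonempty_of_mem hQv)
    omega
  rw [Finset.prod_mul_distrib, Finset.prod_pow_eq_pow_sum, ← hexp, pow_add,
    ← Finset.mul_prod_erase ρ (fun Q => ((Q.card * treeNumber Q.card : ℕ) : ℝ)) hQv]
  push_cast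
  ring

/-- **One set partition in the two-weight tree bound**: for a set partition `ρ` of `B ∖ u`, `v ∈ B ∖ u`,
a point `y` and a measurable weight `Ψ ≥ 0`,
`∫⁻ Ψ(x_v) ∏_{Q ∈ ρ} (∑_{u' ∈ Q} 𝟙[O y (x u')]) |u_Q(x)| dℙ ≤ (∫⁻ Ψ dν) (∏_Q #Q t(#Q)) p^{#B−2}`
(independent blocks; the block of `v` is the weighted one). [cite: PulvirentiTsagkarogiannis2012, §4] -/
theorem lintegral_mul_prod_blockWeight_le (hO : MeasurableSet {p : X × X | O p.1 p.2})
    (hOs : ∀ a b, O a b → O b a) {p : ℝ} (hp0 : 0 ≤ p)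
    (hp : ∀ z, ν {y | O z y} ≤ ENNReal.ofReal p) {B : Finset ι} {u v : ι} (hu : u ∈ B)
    (hvB : v ∈ B.erase u) {ρ : Finset (Finset ι)} (hρ : IsSetPartition (B.erase u) ρ) (y : X)
    {Ψ : X → ℝ≥0∞} (hΨ : Measurable Ψ) :
    ∫⁻ x, Ψ (x v) * ∏ Q ∈ ρ, ENNReal.ofReal ((∑ u' ∈ Q, olap O y (x u')) * |uR O x Q|)
        ∂Measure.pi (fun _ : ι => ν) ≤
      (∫⁻ b, Ψ b ∂ν) * ENNReal.ofReal ((∏ Q ∈ ρ, ((Q.card * treeNumber Q.card : ℕ) : ℝ)) * p ^ (B.card - 2)) := by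
  set P := Measure.pi (fun _ : ι => ν) with hP
  set G : Finset ι → (ι → X) → ℝ≥0∞ := fun Q x =>
    ENNReal.ofReal ((∑ u' ∈ Q, olap O y (x u')) * |uR O x Q|) with hG
  have hGm : ∀ Q, Measurable (G Q) := fun Q =>
    (measurable_blockWeight hO Q).comp (measurable_id.prodMk measurable_const)
  have hGd : ∀ Q, DependsOn (G Q) (Q : Set ι) := fun Q => dependsOn_blockWeight Q y
  set Qv : Finset ι := blockOf ρ v with hQvdef
  have hQv : Qv ∈ ρ := hρ.blockOf_mem hvB
  have hvQv : v ∈ Qv := hρ.mem_blockOf hvB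
  -- the block functions, the block of `v` carrying the weight
  set F : Finset ι → (ι → X) → ℝ≥0∞ := fun Q x => if Q = Qv then Ψ (x v) * G Q x else G Q x with hF
  have hFm : ∀ Q ∈ ρ, Measurable (F Q) := by
    intro Q _
    by_cases hQQ : Q = Qv
    · simp only [hF, hQQ, if_true]
      exact (hΨ.comp (measurable_pi_apply v)).mul (hGm Qv)
    · simp only [hF, hQQ, if_false]
      exact hGm Q
  have hFd : ∀ Q ∈ ρ, DependsOn (F Q) (Q : Set ι) := by
    intro Q _ x x' hxx'
    by_cases hQQ : Q = Qv
    · subst hQQ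
      simp only [hF, if_true]
      rw [hxx' v hvQv, hGd _ hxx']
    · simp only [hF, hQQ, if_false]
      exact hGd Q hxx'
  have hprodF : ∀ x, Ψ (x v) * ∏ Q ∈ ρ, G Q x = ∏ Q ∈ ρ, F Q x := by
    intro x
    rw [← Finset.mul_prod_erase ρ (fun Q => F Q x) hQv, ← Finset.mul_prod_erase ρ (fun Q => G Q x) hQv]
    have h1 : ∏ Q ∈ ρ.erase Qv, F Q x = ∏ Q ∈ ρ.erase Qv, G Q x :=
      Finset.prod_congr rfl fun Q hQ => by simp only [hF, (Finset.mem_erase.1 hQ).1, if_false]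
    rw [h1]
    simp only [hF, if_true]
    ring
  -- block bounds
  set c : Finset ι → ℝ≥0∞ := fun Q =>
    if Q = Qv then ENNReal.ofReal (Q.card : ℝ) * ((∫⁻ b, Ψ b ∂ν) * ENNReal.ofReal (treeNumber Q.card * p ^ (Q.card - 1)))
    else ENNReal.ofReal ((Q.card : ℝ) * treeNumber Q.card * p ^ Q.card) with hc
  have hblock : ∀ Q ∈ ρ, ∫⁻ x, F Q x ∂P ≤ c Q := by
    intro Q hQ
    by_cases hQQ : Q = Qv
    · simp only [hF, hc, hQQ, if_true]
      exact lintegral_mul_blockWeight_le ν hO hOs hp0 hp hvQv y hΨ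
    · simp only [hF, hc, hQQ, if_false]
      exact lintegral_blockWeight_le ν hO hOs hp0 hp (hρ.nonempty_of_mem hQ) y
  have hprodc : ∏ Q ∈ ρ, c Q =
      (∫⁻ b, Ψ b ∂ν) * ENNReal.ofReal ((∏ Q ∈ ρ, ((Q.card * treeNumber Q.card : ℕ) : ℝ)) * p ^ (B.card - 2)) := by
    rw [← Finset.mul_prod_erase ρ (fun Q => c Q) hQv]
    have h1 : ∏ Q ∈ ρ.erase Qv, c Q =
        ENNReal.ofReal (∏ Q ∈ ρ.erase Qv, ((Q.card : ℝ) * treeNumber Q.card * p ^ Q.card)) := by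
      rw [ENNReal.ofReal_prod_of_nonneg fun Q _ => by positivity]
      exact Finset.prod_congr rfl fun Q hQ => by simp only [hc, (Finset.mem_erase.1 hQ).1, if_false]
    rw [h1]
    simp only [hc, if_true]
    have hA : 0 ≤ (Qv.card : ℝ) * (treeNumber Qv.card * p ^ (Qv.card - 1)) := by positivity
    rw [← blockProduct_eq hu hρ hQv p, ENNReal.ofReal_mul hA,
      ENNReal.ofReal_mul (p := (Qv.card : ℝ)) (q := treeNumber Qv.card * p ^ (Qv.card - 1)) (Nat.cast_nonneg _)]
    ring
  calc ∫⁻ x, Ψ (x v) * ∏ Q ∈ ρ, G Q x ∂P = ∫⁻ x, ∏ Q ∈ ρ, F Q x ∂P := by simp_rw [hprodF]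
    _ = ∏ Q ∈ ρ, ∫⁻ x, F Q x ∂P := lintegral_prod_eq_prod_lintegral ν hρ.pairwiseDisjoint hFm hFd
    _ ≤ ∏ Q ∈ ρ, c Q := Finset.prod_le_prod' hblock
    _ = _ := hprodc

/-- **The two-weight tree bound.** Let `O` be symmetric and measurable with `ν{y : O z y} ≤ p` for all `z`,
let `u ≠ v` be two labels of the block `B`, `φ ≥ 0` a measurable weight on `X` and `Φ ≥ 0` a jointly
measurable weight on `X × X`. Then
`∫⁻ φ(x_u) Φ(x_u, x_v) |u_B(x)| dℙ ≤ (∫⁻ φ(z) (∫⁻ Φ(z,y) dν(y)) dν(z)) · t(#B) p^{#B − 2}`.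
One step of the rooted recursion at `u` (`abs_uR_le_sum_setPartitions`): integrate out `x_u = z` first; the
blocks of `B ∖ u` are independent; the block of `v` keeps the weight `Φ(z, x_v)` and loses its overlap
indicator (tree bound `lintegral_mul_aU_le` rooted at `v`: `#Q · (∫⁻ Φ(z,·) dν) · t(#Q) p^{#Q−1}`), every other
block `Q` contributes `#Q · t(#Q) p^{#Q}` (tree bound rooted at the point overlapping `z`); finally
`∑_ρ ∏_Q #Q t(#Q) = t(#B)`. [cite: PulvirentiTsagkarogiannis2012, §4] -/
theorem lintegral_mul_mul₂_aU_le (hO : MeasurableSet {p : X × X | O p.1 p.2})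
    (hOs : ∀ a b, O a b → O b a) {p : ℝ} (hp0 : 0 ≤ p)
    (hp : ∀ z, ν {y | O z y} ≤ ENNReal.ofReal p) (B : Finset ι) {u v : ι} (hu : u ∈ B) (hv : v ∈ B)
    (huv : u ≠ v) {φ : X → ℝ≥0∞} (hφ : Measurable φ) {Φ : X → X → ℝ≥0∞}
    (hΦ : Measurable fun q : X × X => Φ q.1 q.2) :
    ∫⁻ x, φ (x u) * Φ (x u) (x v) * aU O x B ∂Measure.pi (fun _ : ι => ν) ≤
      (∫⁻ z, φ z * ∫⁻ y, Φ z y ∂ν ∂ν) * ENNReal.ofReal (treeNumber B.card * p ^ (B.card - 2)) := by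
  set P := Measure.pi (fun _ : ι => ν) with hP
  set G : Finset ι → X → (ι → X) → ℝ≥0∞ := fun Q y x =>
    ENNReal.ofReal ((∑ u' ∈ Q, olap O y (x u')) * |uR O x Q|) with hG
  have hGm2 : ∀ Q, Measurable fun q : (ι → X) × X => G Q q.2 q.1 := fun Q => measurable_blockWeight hO Q
  have hGd : ∀ Q y, DependsOn (G Q y) (Q : Set ι) := fun Q y => dependsOn_blockWeight Q y
  have hGm3 : ∀ Q, Measurable fun x : ι → X => G Q (x u) x := fun Q =>
    (hGm2 Q).comp (measurable_id.prodMk (measurable_pi_apply u))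
  have hφu : Measurable fun x : ι → X => φ (x u) := hφ.comp (measurable_pi_apply u)
  have hΦuv : Measurable fun x : ι → X => Φ (x u) (x v) :=
    hΦ.comp (f := fun x : ι → X => (x u, x v)) ((measurable_pi_apply u).prodMk (measurable_pi_apply v))
  have hΦy : ∀ y, Measurable (Φ y) := fun y => hΦ.comp (measurable_const.prodMk measurable_id)
  have hmeas_sum : ∀ ρ ∈ setPartitions (B.erase u),
      Measurable fun x : ι → X => φ (x u) * Φ (x u) (x v) * ∏ Q ∈ ρ, G Q (x u) x := fun ρ _ =>
    (hφu.mul hΦuv).mul (Finset.measurable_prod ρ fun Q _ => hGm3 Q)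
  have hvB : v ∈ B.erase u := mem_erase.2 ⟨huv.symm, hv⟩
  -- Step 1: pointwise domination by the rooted recursion at `u`
  have hpt : ∀ x : ι → X, φ (x u) * Φ (x u) (x v) * aU O x B ≤
      ∑ ρ ∈ setPartitions (B.erase u), φ (x u) * Φ (x u) (x v) * ∏ Q ∈ ρ, G Q (x u) x := by
    intro x
    rw [← Finset.mul_sum]
    gcongr
    simp only [aU, hG]
    calc ENNReal.ofReal |uR O x B|
        ≤ ENNReal.ofReal (∑ ρ ∈ setPartitions (B.erase u),
            ∏ Q ∈ ρ, (∑ u' ∈ Q, olap O (x u) (x u')) * |uR O x Q|) :=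
          ENNReal.ofReal_le_ofReal (abs_uR_le_sum_setPartitions hOs x hu)
      _ = _ := by
          rw [ENNReal.ofReal_sum_of_nonneg fun ρ _ => Finset.prod_nonneg fun Q _ =>
            mul_nonneg (Finset.sum_nonneg fun _ _ => olap_nonneg _ _) (abs_nonneg _)]
          refine Finset.sum_congr rfl fun ρ _ => ?_
          exact ENNReal.ofReal_prod_of_nonneg fun Q _ =>
            mul_nonneg (Finset.sum_nonneg fun _ _ => olap_nonneg _ _) (abs_nonneg _)
  -- Step 2: one set partition `ρ` of `B \ u`: integrate out `x u` first
  have hρ : ∀ ρ ∈ setPartitions (B.erase u),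
      ∫⁻ x, φ (x u) * Φ (x u) (x v) * ∏ Q ∈ ρ, G Q (x u) x ∂P ≤
        (∫⁻ z, φ z * ∫⁻ y, Φ z y ∂ν ∂ν) *
          ENNReal.ofReal ((∏ Q ∈ ρ, ((Q.card * treeNumber Q.card : ℕ) : ℝ)) * p ^ (B.card - 2)) := by
    intro ρ hρ
    have hρ' := mem_setPartitions.1 hρ
    rw [lintegral_pi_eq_lintegral_update ν u (hmeas_sum ρ hρ)]
    have hupd : ∀ (x : ι → X) (y : X),
        φ (Function.update x u y u) * Φ (Function.update x u y u) (Function.update x u y v) *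
            ∏ Q ∈ ρ, G Q (Function.update x u y u) (Function.update x u y) =
          φ y * Φ y (x v) * ∏ Q ∈ ρ, G Q y x := by
      intro x y
      rw [Function.update_self, Function.update_of_ne huv.symm]
      congr 1
      refine Finset.prod_congr rfl fun Q hQ => hGd Q y fun i hi => ?_
      have hiu : i ≠ u := fun h => (Finset.mem_erase.1 (hρ'.subset hQ (h ▸ hi))).1 rfl
      exact Function.update_of_ne hiu _ _
    simp_rw [hupd]
    have hsw : ∫⁻ x, ∫⁻ y, φ y * Φ y (x v) * ∏ Q ∈ ρ, G Q y x ∂ν ∂P =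
        ∫⁻ y, ∫⁻ x, φ y * Φ y (x v) * ∏ Q ∈ ρ, G Q y x ∂P ∂ν := by
      refine lintegral_lintegral_swap ((((hφ.comp measurable_snd).mul ?_)).mul
        (Finset.measurable_prod _ fun Q _ => hGm2 Q)).aemeasurable
      exact hΦ.comp (f := fun q : (ι → X) × X => (q.2, q.1 v))
        (measurable_snd.prodMk ((measurable_pi_apply v).comp measurable_fst))
    rw [hsw]
    have hM : Measurable fun z => ∫⁻ y, Φ z y ∂ν := hΦ.lintegral_prod_right'
    have hinner : ∀ y, ∫⁻ x, φ y * Φ y (x v) * ∏ Q ∈ ρ, G Q y x ∂P ≤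
        φ y * (∫⁻ b, Φ y b ∂ν) *
          ENNReal.ofReal ((∏ Q ∈ ρ, ((Q.card * treeNumber Q.card : ℕ) : ℝ)) * p ^ (B.card - 2)) := by
      intro y
      have hm : Measurable fun x : ι → X => Φ y (x v) * ∏ Q ∈ ρ, G Q y x :=
        ((hΦy y).comp (measurable_pi_apply v)).mul
          (Finset.measurable_prod _ fun Q _ => (hGm2 Q).comp (measurable_id.prodMk measurable_const))
      have h3 : ∀ x, φ y * Φ y (x v) * ∏ Q ∈ ρ, G Q y x = φ y * (Φ y (x v) * ∏ Q ∈ ρ, G Q y x) :=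
        fun x => mul_assoc _ _ _
      simp_rw [h3]
      rw [lintegral_const_mul _ hm, mul_assoc]
      exact mul_le_mul' le_rfl (lintegral_mul_prod_blockWeight_le ν hO hOs hp0 hp hu hvB hρ' y (hΦy y))
    calc ∫⁻ y, ∫⁻ x, φ y * Φ y (x v) * ∏ Q ∈ ρ, G Q y x ∂P ∂ν
        ≤ ∫⁻ y, φ y * (∫⁻ b, Φ y b ∂ν) *
            ENNReal.ofReal ((∏ Q ∈ ρ, ((Q.card * treeNumber Q.card : ℕ) : ℝ)) * p ^ (B.card - 2)) ∂ν :=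
          lintegral_mono hinner
      _ = (∫⁻ z, φ z * ∫⁻ y, Φ z y ∂ν ∂ν) *
            ENNReal.ofReal ((∏ Q ∈ ρ, ((Q.card * treeNumber Q.card : ℕ) : ℝ)) * p ^ (B.card - 2)) :=
          lintegral_mul_const _ (hφ.mul hM)
  -- Step 3: sum over `ρ` and evaluate the tree recursion
  calc ∫⁻ x, φ (x u) * Φ (x u) (x v) * aU O x B ∂P
      ≤ ∫⁻ x, ∑ ρ ∈ setPartitions (B.erase u), φ (x u) * Φ (x u) (x v) * ∏ Q ∈ ρ, G Q (x u) x ∂P :=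
        lintegral_mono hpt
    _ = ∑ ρ ∈ setPartitions (B.erase u), ∫⁻ x, φ (x u) * Φ (x u) (x v) * ∏ Q ∈ ρ, G Q (x u) x ∂P :=
        lintegral_finsetSum _ hmeas_sum
    _ ≤ ∑ ρ ∈ setPartitions (B.erase u), (∫⁻ z, φ z * ∫⁻ y, Φ z y ∂ν ∂ν) *
          ENNReal.ofReal ((∏ Q ∈ ρ, ((Q.card * treeNumber Q.card : ℕ) : ℝ)) * p ^ (B.card - 2)) :=
        Finset.sum_le_sum hρ
    _ = (∫⁻ z, φ z * ∫⁻ y, Φ z y ∂ν ∂ν) * ENNReal.ofReal (treeNumber B.card * p ^ (B.card - 2)) := by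
        rw [← Finset.mul_sum]
        congr 1
        have hnn : ∀ ρ ∈ setPartitions (B.erase u),
            0 ≤ (∏ Q ∈ ρ, ((Q.card * treeNumber Q.card : ℕ) : ℝ)) * p ^ (B.card - 2) := fun ρ _ =>
          mul_nonneg (Finset.prod_nonneg fun Q _ => Nat.cast_nonneg _) (pow_nonneg hp0 _)
        rw [← ENNReal.ofReal_sum_of_nonneg hnn, ← Finset.sum_mul]
        congr 2
        have hcard : (B.erase u).card + 1 = B.card := Finset.card_erase_add_one hu
        rw [← hcard, ← sum_setPartitions_prod_card_mul_treeNumber (B.erase u)]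
        push_cast
        rfl


end Generic

/-! ## § 2 The registered sub-goal -/

/-- **Registered sub-goal `stub_contactStatistics_treeBound`** (second piece of stub `stub_contactStatistics`,
S2c, of the line `enskog-compensator-martingale`): the two-weight tree bound for the canonical hard-core gas of
`n` independent `ν`-distributed points of `ℝ³` (symmetric measurable overlap relation with one excluded region of
mass `≤ p`): for `u ≠ v` in one block `B`, `φ ≥ 0` on `ℝ³` and `Φ ≥ 0` on `ℝ³ × ℝ³`,
`∫⁻ φ(x_u) Φ(x_u,x_v) |u_B| dν^{⊗n} ≤ (∫⁻ φ(z) ∫⁻ Φ(z,y) dν(y) dν(z)) · t(#B) p^{#B−2}`.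
[cite: PulvirentiTsagkarogiannis2012, §4] -/
theorem stub_contactStatistics_treeBound : ∀ (n : ℕ) (ν : Measure V3) [IsProbabilityMeasure ν] (O : V3 → V3 → Prop),
    MeasurableSet {p : V3 × V3 | O p.1 p.2} → (∀ a b, O a b → O b a) → ∀ (p : ℝ), 0 ≤ p →
    (∀ z, ν {y | O z y} ≤ ENNReal.ofReal p) → ∀ (B : Finset (Fin n)) (u v : Fin n), u ∈ B → v ∈ B → u ≠ v →
    ∀ (φ : V3 → ℝ≥0∞), Measurable φ → ∀ (Φ : V3 → V3 → ℝ≥0∞), Measurable (fun q : V3 × V3 => Φ q.1 q.2) →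
    ∫⁻ x, φ (x u) * Φ (x u) (x v) * aU O x B ∂Measure.pi (fun _ : Fin n => ν) ≤
      (∫⁻ z, φ z * ∫⁻ y, Φ z y ∂ν ∂ν) * ENNReal.ofReal (treeNumber B.card * p ^ (B.card - 2)) :=
  fun _ ν _ _ hO hOs _ hp0 hp B _ _ hu hv huv _ hφ _ hΦ => lintegral_mul_mul₂_aU_le ν hO hOs hp0 hp B hu hv huv hφ hΦ

end Summit.AtomisticToContinuum.HydrodynamicLimit.Theorems.EnskogCompensator

end
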